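import Summits.CriticalPhenomena.PercolationContinuityZ3.Theses.PercExchangeRateTransport
import Literature.Probability.Percolation.PercolationProofs

/-!
# `ModelFacts` (crux stmt-CriticalPhenomena-16064, route `PercExchangeRateTransport`):
# the degenerate box `n = 0` and tightness of the guard `1 ≤ n` in clause (8)

Negative / tightness lemmas from the refuter's vetting pass (nothing here asserts the crux).

For the label-coupled anisotropic family on `ℤ²×ℤ` (x/y-bonds open iff `U_e ≤ p`, z-bonds iff
`U_e ≤ t`, `U` i.i.d. uniform under `labelMeasure (Site 3)`), the one-arm event at `n = 0` is the
SURE event: `box 3 0 = {0}` and `0 ∈ ∂ⁱⁿ{0}` (every neighbour of the origin lies outside), so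
`{0 ↔ ∂B(0) in B(0)} = univ` (`siteToBoundary_three_zero`) and `Θ_0 ≡ 1` (`theta0_eq_one`).
Consequences recorded for provers of the crux:

* clause (5) (`Antitone` in `n`) and clause (7) (`θ = ⨅ n Θ_n`) are consistent at `n = 0`
  (`Θ_1 ≤ Θ_0 = 1`, `theta1_le_theta0`);
* clause (8) (`0 < ∂_p Θ_n` on the open square) is FALSE without its guard `1 ≤ n`: the
  `p`-derivative of the constant `Θ_0` vanishes (`modelFacts_derivPos_false_without_guard`), so any
  proof of clause (8) must use `1 ≤ n` (it enters through `0 ∉ ∂B(n)`, which makes the bond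
  `s(0, e₀)` pivotal).
-/

namespace Summit.CriticalPhenomena.PercolationContinuityZ3.Theorems.ModelFacts.Negative

open Literature.Probability.Percolation Literature.Probability.LatticeModels MeasureTheory

/-- The one-arm event `{0 ↔ ∂B(0) in B(0)}` on `ℤ³` is the sure event: `0 ∈ ∂ⁱⁿ(box 3 0)` and the
empty walk joins `0` to itself inside the box. [folklore] -/
theorem siteToBoundary_three_zero : siteToBoundary 3 0 = Set.univ := by
  ext ω
  simp only [siteToBoundary, Set.mem_setOf_eq, Set.mem_univ, iff_true]
  refine ⟨0, ?_, ?_⟩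
  · rw [mem_innerBoundary_iff]
    refine ⟨zero_mem_box 3 0, Pi.single 0 1, ?_, ?_⟩
    · intro h
      have h' := (mem_box.mp h 0).2
      simp at h'
    · rw [zdGraph_adj_iff]
      exact ⟨0, Or.inl (by simp)⟩
  · have h0 : (0 : Site 3) ∈ ((box 3 0 : Finset (Site 3)) : Set (Site 3)) := by
      exact_mod_cast zero_mem_box 3 0
    exact ⟨h0, h0, ⟨SimpleGraph.Walk.nil⟩⟩

/-- Hence `Θ_0(p,t) = 1` for all real `p, t` and ANY choice of the vertical-bond predicate
(`labelMeasure` is a probability measure). [folklore] -/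
theorem theta0_eq_one (p t : ℝ) (vert : Sym2 (Site 3) → Prop) :
    (labelMeasure (Site 3)).real {U | {e | e ∈ (zdGraph 3).edgeSet ∧
      ((vert e ∧ U e ≤ t) ∨ (¬ vert e ∧ U e ≤ p))} ∈ siteToBoundary 3 0} = 1 := by
  have := isProbabilityMeasure_labelMeasure (Site 3)
  simp [siteToBoundary_three_zero]

/-- The first step of clause (5) at the degenerate box: `Θ_1 ≤ Θ_0 = 1`. [folklore] -/
theorem theta1_le_theta0 (p t : ℝ) (vert : Sym2 (Site 3) → Prop) :
    (labelMeasure (Site 3)).real {U | {e | e ∈ (zdGraph 3).edgeSet ∧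
        ((vert e ∧ U e ≤ t) ∨ (¬ vert e ∧ U e ≤ p))} ∈ siteToBoundary 3 1}
      ≤ (labelMeasure (Site 3)).real {U | {e | e ∈ (zdGraph 3).edgeSet ∧
        ((vert e ∧ U e ≤ t) ∨ (¬ vert e ∧ U e ≤ p))} ∈ siteToBoundary 3 0} := by
  have := isProbabilityMeasure_labelMeasure (Site 3)
  rw [theta0_eq_one p t vert]
  exact measureReal_le_one

/-- **Tightness of the guard `1 ≤ n` in clause (8) of `ModelFacts`.** With the crux's own
`let`-prefix (`μ`, `vert`, `cfg`, `Θ`), the strict positivity `0 < deriv (fun q => Θ n q t) p` on the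
open square FAILS when quantified over all `n : ℕ`: at `n = 0`, `Θ_0 ≡ 1` has zero `p`-derivative.
So clause (8) as filed (with `1 ≤ n →`) is the minimal correct form. [folklore] -/
theorem modelFacts_derivPos_false_without_guard :
    ¬ (let μ := Literature.Probability.Percolation.labelMeasure (Literature.Probability.LatticeModels.Site 3)
       let vert : Sym2 (Literature.Probability.LatticeModels.Site 3) → Prop :=
         fun e => ∃ x : Literature.Probability.LatticeModels.Site 3, e = s(x, x + Pi.single (2 : Fin 3) 1)
       let cfg : ℝ → ℝ → (Sym2 (Literature.Probability.LatticeModels.Site 3) → ℝ) →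
           Set (Sym2 (Literature.Probability.LatticeModels.Site 3)) :=
         fun p t U => {e | e ∈ (Literature.Probability.LatticeModels.zdGraph 3).edgeSet ∧
           ((vert e ∧ U e ≤ t) ∨ (¬ vert e ∧ U e ≤ p))}
       let Θ : ℕ → ℝ → ℝ → ℝ :=
         fun n p t => μ.real {U | cfg p t U ∈ Literature.Probability.Percolation.siteToBoundary 3 n}
       ∀ n : ℕ, ∀ p ∈ Set.Ioo (0 : ℝ) 1, ∀ t ∈ Set.Ioo (0 : ℝ) 1, 0 < deriv (fun q => Θ n q t) p) := by
  intro h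
  have h0 := h 0 (1 / 2) ⟨by norm_num, by norm_num⟩ (1 / 2) ⟨by norm_num, by norm_num⟩
  have hconst : (fun q : ℝ => (labelMeasure (Site 3)).real
      {U | {e | e ∈ (zdGraph 3).edgeSet ∧
        (((∃ x : Site 3, e = s(x, x + Pi.single (2 : Fin 3) 1)) ∧ U e ≤ (1 / 2 : ℝ)) ∨
         (¬ (∃ x : Site 3, e = s(x, x + Pi.single (2 : Fin 3) 1)) ∧ U e ≤ q))}
        ∈ siteToBoundary 3 0}) = fun _ => (1 : ℝ) := by
    funext q
    exact theta0_eq_one q (1 / 2) _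
  have h1 : deriv (fun _ : ℝ => (1 : ℝ)) (1 / 2) = 0 := deriv_const _ _
  have h0' : (0 : ℝ) < deriv (fun _ : ℝ => (1 : ℝ)) (1 / 2) := by
    have := h0
    simp only at this
    rw [hconst] at this
    exact this
  rw [h1] at h0'
  exact lt_irrefl _ h0'

end Summit.CriticalPhenomena.PercolationContinuityZ3.Theorems.ModelFacts.Negative
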